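import Summits.Ventures.Crystal3D.Theorems.StickyWulffConstantTextureLiminfTexShadowCoverageBarlowSteer2WideDefs
import Mathlib.Analysis.InnerProductSpace.EuclideanDist
import Mathlib.Geometry.Euclidean.Angle.Unoriented.Basic
import HarnessLib

/-!
# TexShadow row (e) / EDGE-ON (ε₂): the STEEP-PLATE corner of the two-sided wide-steered ledger — the launch-failure set in closed form
# (lane T, crux `TextureLiminfV5`, stmt-Ventures-23912, sub-crux EDGE-ON; cf-p1 DECISION (cxxxvii)(2)(b); memo HOME/wall-p1-g15/STEEP-PLATE-g15.md)

HONEST FRAMING. Venture `Summits/Ventures/Crystal3D` (cell `crystal3d-full`), route `route-Ventures-StickyWulffConstant`, helper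
`--supports` the law-v5 crux `TextureLiminfV5` (stmt-Ventures-23912), registered line `TexShadow` v8.5, the EDGE-ON corner of row (e).
DEFINITIONS + two elementary geometric theorems; NO certificate is asserted; nothing about any wall law is proved; rung F-C1 not moved.

THE POINT.  `…CoverageBarlowSteer2WideDefs` types the TWO-SIDED wide-steered certificate `BarlowTwoSidedCertifiedSteerWide c₀ σ₁ σ₂ L₁ L₂
z₁ v₁ z₂ v₂`: plate 1 launches an UP family along a unit steering `z₁` with `‖z₁ − e₃‖ ≤ 1/3` from a reference up-slot `v₁` that is STEEP
FOR `z₁` (`⟪L₁' v₁, z₁⟫ ≥ √2/2`), plate 2 likewise toward `−e₃`, plus flux / frame clauses.  Its g14 cause split (kit j326791/j326792, memo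
K3-g14 §4f) found that 74–95 % of what the ledger leaves of the EDGE-ON regime is LAUNCH FAILURE: a plate with no steerable up-slot.  This
file gives that set IN CLOSED FORM (cf-p1 (cxxxvii)(2)(b) «characterise the launch-failure set geometrically»):
* `steerSteepCos c := (√2/2)·((1 − c²/2) − c·√(1 − c²/4)) = cos(45° + θ_c)`, `θ_c = 2 arcsin(c/2)` the cone angle of the chord-`c` cap
  (`steerSteepCos (1/3) = (17√2 − √70)/36 = 0.43541…`, `steerSteepCos (1/4) = (31√2 − 3√14)/64 = 0.50961…`);
* **`SteepPlateAt c L e`** — EVERY reference up-slot `v` of the up-presentation `upFrame L e` has `e`-rise `⟪upFrame L e v, e⟫ < steerSteepCos c`: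
  the direction `(upFrame L e)⁻¹ e` lies OUTSIDE the three spherical caps of angular radius `45° + θ_c` about `upSlot₁, upSlot₂, upSlot₃`
  (memo §1: a sub-band `β > 79.29°` of the edge-on belt minus three azimuth windows; solid angle `0.013884` of `S²` = `2.78 %` of the
  half-sphere per plate at `c = 1/3`; `0.033879` = `6.78 %` at `c = 1/4`; independent of `σ`);
* **`SteepPairAt c σ₁ σ₂ L₁ L₂ := SteepPlateAt c L₁ e₃ ∨ SteepPlateAt c L₂ (−e₃)`** in the regime shape of the `…On Reg` schemas;
* **`SteerLaunchAt c L σ e z v`** — the LAUNCH clauses of one plate of `BarlowTwoSidedCertifiedSteerWide` (unit `z` within chord `c` of `e`,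
  reference up-slot `v` steep for `z`, the `z`-best ∇-capper's `e`-rise `≥ 1/4` on ∇-bilayers), and `steerLaunchAt_of_twoSided` (projection).
THEOREMS (elementary sphere geometry, the spherical triangle inequality `InnerProductGeometry.angle_le_angle_add_angle`):
* `inner_ge_steerSteepCos_of_steep_of_near` — `‖a‖ = ‖z‖ = ‖e‖ = 1`, `⟪a, z⟫ ≥ √2/2`, `‖z − e‖ ≤ c` (`0 ≤ c ≤ 1`) ⇒ `⟪a, e⟫ ≥ steerSteepCos c`;
* **`not_steerLaunchAt_of_steepPlateAt`** — a steep plate admits NO launch `(z, v)` at chord `c`; hence **`not_twoSidedSteerWide_of_steepPairAt`**: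
  a steep pair is not `BarlowTwoSidedCertifiedSteerWide`-certified by ANY steering — the corner is real for this ledger (the converse
  «not steep ⇒ launchable», with the explicit steering of memo §2 and its capper floor `1/(2√3) > 1/4`, is the numerically confirmed
  part (kit j327556/j327557) and is NOT claimed here);
* `not_deltaSteep_of_steepPlateAt` / `edgeOnAt_of_steep_steep` — steep plates are not Δ-steep, so a doubly steep pair is in `EdgeOnAt c₀`.
WHAT THIS IS NOT: no coverage certificate; the «not steep ⇒ launch» direction is not proved here; F-C1 not moved.
-/

noncomputable section

open scoped BigOperators InnerProductSpace ENNReal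
open MeasureTheory Filter

namespace Summit.Ventures.Crystal3D.Cruxes.TextureLiminf.TexShadow

open Summit.Ventures.Crystal3D Summit.Ventures.Crystal3D.Theorems
open Literature.MathematicalPhysics.StatisticalMechanics (IsHaggSeq fccStacking barlowStacking basalMirror)

/-! ## The steepness threshold of a steering chord -/

/-- **`steerSteepCos c = cos(45° + θ_c)`**, `θ_c = 2·arcsin(c/2)` (so `cos θ_c = 1 − c²/2`, `sin θ_c = c·√(1 − c²/4)`): the least `e`-rise a
unit slot can have while being steep (`45°`) for SOME unit steering within chord `c` of `e`.  Closed √-form. -/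
def steerSteepCos (c : ℝ) : ℝ :=
  Real.sqrt 2 / 2 * ((1 - c ^ 2 / 2) - c * Real.sqrt (1 - c ^ 2 / 4))

/-- The threshold of record (chord `1/3`, the WIDE ledger): `steerSteepCos (1/3) = (17√2 − √70)/36 ≈ 0.435418`. -/
theorem steerSteepCos_third : steerSteepCos (1 / 3) = (17 * Real.sqrt 2 - Real.sqrt 70) / 36 := by
  unfold steerSteepCos
  have h35 : Real.sqrt (1 - (1 / 3 : ℝ) ^ 2 / 4) = Real.sqrt 35 / 6 := by
    rw [show (1 - (1 / 3 : ℝ) ^ 2 / 4) = 35 / 36 by norm_num, Real.sqrt_div' _ (by norm_num : (0 : ℝ) ≤ 36),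
      show Real.sqrt 36 = 6 by rw [show (36 : ℝ) = 6 ^ 2 by norm_num, Real.sqrt_sq (by norm_num : (0 : ℝ) ≤ 6)]]
  have h70 : Real.sqrt 70 = Real.sqrt 2 * Real.sqrt 35 := by
    rw [← Real.sqrt_mul (by norm_num : (0 : ℝ) ≤ 2)]; norm_num
  rw [h35, h70]; ring

/-- The chord-`1/4` threshold: `steerSteepCos (1/4) = (31√2 − 3√14)/64 ≈ 0.509620`. -/
theorem steerSteepCos_quarter : steerSteepCos (1 / 4) = (31 * Real.sqrt 2 - 3 * Real.sqrt 14) / 64 := by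
  unfold steerSteepCos
  have h63 : Real.sqrt (1 - (1 / 4 : ℝ) ^ 2 / 4) = 3 * Real.sqrt 7 / 8 := by
    rw [show (1 - (1 / 4 : ℝ) ^ 2 / 4) = 63 / 64 by norm_num, Real.sqrt_div' _ (by norm_num : (0 : ℝ) ≤ 64),
      show Real.sqrt 64 = 8 by rw [show (64 : ℝ) = 8 ^ 2 by norm_num, Real.sqrt_sq (by norm_num : (0 : ℝ) ≤ 8)],
      show (63 : ℝ) = 3 ^ 2 * 7 by norm_num, Real.sqrt_mul (by norm_num : (0 : ℝ) ≤ 3 ^ 2), Real.sqrt_sq (by norm_num : (0 : ℝ) ≤ 3)]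
  have h14 : Real.sqrt 14 = Real.sqrt 2 * Real.sqrt 7 := by
    rw [← Real.sqrt_mul (by norm_num : (0 : ℝ) ≤ 2)]; norm_num
  rw [h63, h14]; ring

/-- `steerSteepCos c ≤ √2/2` for `0 ≤ c` (a steep plate is in particular not Δ-steep). -/
theorem steerSteepCos_le (c : ℝ) (hc0 : 0 ≤ c) : steerSteepCos c ≤ Real.sqrt 2 / 2 := by
  unfold steerSteepCos
  have hs2 : 0 ≤ Real.sqrt 2 / 2 := by positivity
  have hroot : 0 ≤ Real.sqrt (1 - c ^ 2 / 4) := Real.sqrt_nonneg _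
  have hle : (1 - c ^ 2 / 2) - c * Real.sqrt (1 - c ^ 2 / 4) ≤ 1 := by nlinarith [mul_nonneg hc0 hroot, sq_nonneg c]
  calc Real.sqrt 2 / 2 * ((1 - c ^ 2 / 2) - c * Real.sqrt (1 - c ^ 2 / 4)) ≤ Real.sqrt 2 / 2 * 1 :=
        mul_le_mul_of_nonneg_left hle hs2
    _ = Real.sqrt 2 / 2 := mul_one _

/-! ## The steep plate, the steep pair, the launch clauses -/

/-- **STEEP PLATE at chord `c`** (the launch-failure set of the steered ledgers, in closed form): every reference up-slot `v` of the
up-presentation of `(L, ·)` toward `e` rises by LESS than `steerSteepCos c` along `e` — equivalently the model direction `(upFrame L e)⁻¹ e`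
lies outside the three caps of angular radius `45° + θ_c` about `upSlot₁, upSlot₂, upSlot₃`.  `σ`-free. -/
def SteepPlateAt (c : ℝ) (L : E3 ≃ₗᵢ[ℝ] E3) (e : E3) : Prop :=
  ∀ v ∈ fccSlots, v 2 = Real.sqrt (2 / 3) → ⟪upFrame L e v, e⟫_ℝ < steerSteepCos c

/-- **STEEP PAIR at chord `c`** (regime shape): plate 1 is steep toward `e₃` or plate 2 is steep toward `−e₃`. -/
def SteepPairAt (c : ℝ) (_σ₁ _σ₂ : ℤ → ℤ) (L₁ L₂ : E3 ≃ₗᵢ[ℝ] E3) : Prop :=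
  SteepPlateAt c L₁ e₃ ∨ SteepPlateAt c L₂ (-e₃)

/-- **The LAUNCH clauses of one plate** of `BarlowTwoSidedCertifiedSteerWide` (plate `(L, σ)` presented toward `e`, steering `z`, slot `v`,
chord `c`): `‖z‖ = 1`, `‖z − e‖ ≤ c`, `v` a reference up-slot, `v` steep for `z`, and on every ∇-bilayer of the up-word the `z`-best capper of
the basal twin rises by `≥ 1/4` along `e`. -/
def SteerLaunchAt (c : ℝ) (L : E3 ≃ₗᵢ[ℝ] E3) (σ : ℤ → ℤ) (e z v : E3) : Prop :=
  ‖z‖ = 1 ∧ ‖z - e‖ ≤ c ∧ v ∈ fccSlots ∧ v 2 = Real.sqrt (2 / 3) ∧ Real.sqrt 2 / 2 ≤ ⟪upFrame L e v, z⟫_ℝ ∧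
    ∀ i : ℤ, upWord L σ e i = -1 →
      (1 / 4 : ℝ) ≤ ⟪upFrame L e (basalMirror (bestCapper (twinFrame (upFrame L e) (upFrame L e e₃)) (upFrame L e e₃) z)), e⟫_ℝ

/-- A two-sidedly certified pair launches both plates (projection of the definition; chord `1/3`). -/
theorem steerLaunchAt_of_twoSided {c₀ : ℝ} {σ₁ σ₂ : ℤ → ℤ} {L₁ L₂ : E3 ≃ₗᵢ[ℝ] E3} {z₁ v₁ z₂ v₂ : E3}
    (h : BarlowTwoSidedCertifiedSteerWide c₀ σ₁ σ₂ L₁ L₂ z₁ v₁ z₂ v₂) :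
    SteerLaunchAt (1 / 3) L₁ σ₁ e₃ z₁ v₁ ∧ SteerLaunchAt (1 / 3) L₂ σ₂ (-e₃) z₂ v₂ := by
  obtain ⟨hz₁, hc₁, hv₁, hv₁2, hs₁, hcap₁, hz₂, hc₂, hv₂, hv₂2, hs₂, hcap₂, _⟩ := h
  exact ⟨⟨hz₁, hc₁, hv₁, hv₁2, hs₁, hcap₁⟩, ⟨hz₂, hc₂, hv₂, hv₂2, hs₂, hcap₂⟩⟩

/-! ## Sphere geometry: steep for a near steering ⇒ rise ≥ `steerSteepCos` -/

/-- **Spherical triangle inequality, quantitative**: unit vectors `a, z, e` with `⟪a, z⟫ ≥ √2/2` (`∠(a,z) ≤ 45°`) and `‖z − e‖ ≤ c`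
(`∠(z,e) ≤ θ_c`), `0 ≤ c ≤ 1`, satisfy `⟪a, e⟫ ≥ cos(45° + θ_c) = steerSteepCos c`. -/
theorem inner_ge_steerSteepCos_of_steep_of_near {a z e : E3} {c : ℝ} (ha : ‖a‖ = 1) (hz : ‖z‖ = 1) (he : ‖e‖ = 1)
    (hc0 : 0 ≤ c) (hc1 : c ≤ 1) (hsteep : Real.sqrt 2 / 2 ≤ ⟪a, z⟫_ℝ) (hnear : ‖z - e‖ ≤ c) :
    steerSteepCos c ≤ ⟪a, e⟫_ℝ := by
  open InnerProductGeometry in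
  have ha0 : a ≠ 0 := fun h => by rw [h, norm_zero] at ha; exact zero_ne_one ha
  have hz0 : z ≠ 0 := fun h => by rw [h, norm_zero] at hz; exact zero_ne_one hz
  have he0 : e ≠ 0 := fun h => by rw [h, norm_zero] at he; exact zero_ne_one he
  -- cosines of the three angles
  have caz : Real.cos (angle a z) = ⟪a, z⟫_ℝ := by rw [cos_angle, ha, hz, mul_one, div_one]
  have cze : Real.cos (angle z e) = ⟪z, e⟫_ℝ := by rw [cos_angle, hz, he, mul_one, div_one]
  have cae : Real.cos (angle a e) = ⟪a, e⟫_ℝ := by rw [cos_angle, ha, he, mul_one, div_one]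
  -- ⟪z, e⟫ ≥ 1 - c²/2 from the chord
  have hze : 1 - c ^ 2 / 2 ≤ ⟪z, e⟫_ℝ := by
    have hsq : ‖z - e‖ ^ 2 = 2 - 2 * ⟪z, e⟫_ℝ := by
      rw [@norm_sub_sq_real, hz, he]; ring
    have hle : ‖z - e‖ ^ 2 ≤ c ^ 2 := pow_le_pow_left₀ (norm_nonneg _) hnear 2
    nlinarith
  -- the angle bounds
  set x : ℝ := 1 - c ^ 2 / 2 with hx
  have hx0 : 0 ≤ x := by rw [hx]; nlinarith
  have hx1 : x ≤ 1 := by rw [hx]; nlinarith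
  have h1 : angle a z ≤ Real.pi / 4 := by
    have : Real.arccos ⟪a, z⟫_ℝ ≤ Real.arccos (Real.sqrt 2 / 2) := Real.arccos_le_arccos hsteep
    rw [← caz, Real.arccos_cos (angle_nonneg a z) (angle_le_pi a z)] at this
    rwa [show Real.arccos (Real.sqrt 2 / 2) = Real.pi / 4 by
      rw [← Real.cos_pi_div_four, Real.arccos_cos (by positivity) (by linarith [Real.pi_pos])]] at this
  have h2 : angle z e ≤ Real.arccos x := by
    have : Real.arccos ⟪z, e⟫_ℝ ≤ Real.arccos x := Real.arccos_le_arccos hze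
    rwa [← cze, Real.arccos_cos (angle_nonneg z e) (angle_le_pi z e)] at this
  have hax : Real.arccos x ≤ Real.pi / 2 := Real.arccos_le_pi_div_two.mpr hx0
  have htri : angle a e ≤ Real.pi / 4 + Real.arccos x :=
    (angle_le_angle_add_angle a z e).trans (add_le_add h1 h2)
  have hΘpi : Real.pi / 4 + Real.arccos x ≤ Real.pi := by linarith [Real.pi_pos]
  -- cos is antitone on [0, π]
  have hcos : Real.cos (Real.pi / 4 + Real.arccos x) ≤ Real.cos (angle a e) :=
    Real.cos_le_cos_of_nonneg_of_le_pi (angle_nonneg a e) hΘpi htri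
  -- evaluate cos(π/4 + arccos x)
  have hsin : Real.sin (Real.arccos x) = c * Real.sqrt (1 - c ^ 2 / 4) := by
    rw [Real.sin_arccos, hx]
    have hin : 1 - (1 - c ^ 2 / 2) ^ 2 = c ^ 2 * (1 - c ^ 2 / 4) := by ring
    rw [hin, Real.sqrt_mul (sq_nonneg c), Real.sqrt_sq hc0]
  have hval : Real.cos (Real.pi / 4 + Real.arccos x) = steerSteepCos c := by
    rw [Real.cos_add, Real.cos_pi_div_four, Real.sin_pi_div_four, Real.cos_arccos (by linarith) hx1, hsin, steerSteepCos, hx]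
    ring
  rw [hval, cae] at hcos
  exact hcos

/-! ## The corner is real: steep plates admit no launch -/

/-- **A steep plate admits no launch at chord `c`** (`0 ≤ c ≤ 1`, `‖e‖ = 1`): for every steering `z` and slot `v`, `¬ SteerLaunchAt c L σ e z v`. -/
theorem not_steerLaunchAt_of_steepPlateAt {c : ℝ} {L : E3 ≃ₗᵢ[ℝ] E3} {e : E3} (hc0 : 0 ≤ c) (hc1 : c ≤ 1) (he : ‖e‖ = 1)
    (h : SteepPlateAt c L e) (σ : ℤ → ℤ) (z v : E3) : ¬ SteerLaunchAt c L σ e z v := by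
  rintro ⟨hz, hnear, hv, hv2, hsteep, -⟩
  have ha : ‖upFrame L e v‖ = 1 := by rw [LinearIsometryEquiv.norm_map, norm_eq_one_of_mem_fccSlots hv]
  exact absurd (inner_ge_steerSteepCos_of_steep_of_near ha hz he hc0 hc1 hsteep hnear) (not_le.mpr (h v hv hv2))

/-- `‖e₃‖ = 1`. -/
theorem norm_e₃_eq_one : ‖(e₃ : E3)‖ = 1 := by
  rw [e₃, PiLp.norm_single, norm_one]

/-- **A steep pair is not certified by the two-sided wide-steered ledger, whatever the steerings and slots** (the EDGE-ON corner of
(ε₂) is real for this ledger). -/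
theorem not_twoSidedSteerWide_of_steepPairAt {c₀ : ℝ} {σ₁ σ₂ : ℤ → ℤ} {L₁ L₂ : E3 ≃ₗᵢ[ℝ] E3}
    (h : SteepPairAt (1 / 3) σ₁ σ₂ L₁ L₂) (z₁ v₁ z₂ v₂ : E3) :
    ¬ BarlowTwoSidedCertifiedSteerWide c₀ σ₁ σ₂ L₁ L₂ z₁ v₁ z₂ v₂ := by
  intro hcert
  obtain ⟨h₁, h₂⟩ := steerLaunchAt_of_twoSided hcert
  have hn : ‖(-e₃ : E3)‖ = 1 := by rw [norm_neg, norm_e₃_eq_one]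
  rcases h with hs | hs
  · exact not_steerLaunchAt_of_steepPlateAt (by norm_num) (by norm_num) norm_e₃_eq_one hs σ₁ z₁ v₁ h₁
  · exact not_steerLaunchAt_of_steepPlateAt (by norm_num) (by norm_num) hn hs σ₂ z₂ v₂ h₂

/-! ## Steep plates are edge-on -/

/-- A steep plate (`0 ≤ c`) is not Δ-steep toward `e`. -/
theorem not_deltaSteep_of_steepPlateAt {c : ℝ} {L : E3 ≃ₗᵢ[ℝ] E3} {e : E3} (hc0 : 0 ≤ c)
    (h : SteepPlateAt c L e) : ¬ DeltaSteep L e := by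
  rintro ⟨v, hv, hv2, hsteep⟩
  exact absurd ((h v hv hv2).trans_le (steerSteepCos_le c hc0)) (not_lt.mpr hsteep)

/-- A steep plate is not flux-feasible (any `c₀`, any word). -/
theorem not_fluxFeasible_of_steepPlateAt {c : ℝ} {L : E3 ≃ₗᵢ[ℝ] E3} {e : E3} (hc0 : 0 ≤ c)
    (h : SteepPlateAt c L e) (c₀ : ℝ) (σ : ℤ → ℤ) : ¬ FluxFeasible c₀ L σ e :=
  fun hf => not_deltaSteep_of_steepPlateAt hc0 h hf.1

/-- **Doubly steep pairs are edge-on**: both plates steep (`0 ≤ c`) ⇒ `EdgeOnAt c₀`. -/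
theorem edgeOnAt_of_steep_steep {c c₀ : ℝ} {σ₁ σ₂ : ℤ → ℤ} {L₁ L₂ : E3 ≃ₗᵢ[ℝ] E3} (hc0 : 0 ≤ c)
    (h₁ : SteepPlateAt c L₁ e₃) (h₂ : SteepPlateAt c L₂ (-e₃)) : EdgeOnAt c₀ σ₁ σ₂ L₁ L₂ :=
  ⟨not_fluxFeasible_of_steepPlateAt hc0 h₁ c₀ σ₁, not_fluxFeasible_of_steepPlateAt hc0 h₂ c₀ σ₂⟩

end Summit.Ventures.Crystal3D.Cruxes.TextureLiminf.TexShadow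

end
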